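/-
Copyright (c) 2026. All rights reserved.
Released under Apache 2.0 license as described in the file LICENSE.
Authors: abc-iut cell, wave-2 seat abc-iut-L3-t11 (proof-only; merge abc-iut-S1 → abc-iut-L4-t3).
-/
import Literature.AnabelianGeometry.AbsoluteAnabelian.LocalVolumesNonarchimedean
import Literature.IUT.LogVolume.LogSeriesEstimates
import HarnessLib

/-!
# [AbsTopIII] Prop 5.7 (i)(c), analytic input: the real `p`-adic logarithm is isometric on small balls

S. Mochizuki, *Topics in absolute anabelian geometry III*, J. Math. Sci. Univ. Tokyo 22 (2015)
[MochizukiAbsTopIII2015], Prop 5.7 (i)(c) (log-compatibility of the log-volume), manuscript p. 138, and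
its proof p. 139: "`log_k` determines a bijection `x + 𝔪_k^n ≅ log_k(x) + 𝔪_k^n`" for units `x` and all
sufficiently large `n`.

Seat abc-iut-L4-t3 (`LocalVolumesNonarchimedean.lean`, p403734) isolated exactly this analytic input as
the predicate `IsIsometricOnSmallBalls (log : K → K)` — some `r₀ > 0` such that `log` maps every closed
ball of radius `r ≤ r₀` centred at a unit ONTO the closed ball of the same radius centred at the image —
flagged `TODO-merge:abc-iut-S1`, and typed the combinatorial half as the named fact
`LogVolumeCompatibleOfIsometric` (held by abc-iut-L4-t8). This PROOF-ONLY file discharges the analytic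
half at abc-iut-S1's REAL logarithm `unitLog = log_p` (`Literature.IUT.LogVolume.LocalUnitLog`, p403893):

* `isIsometricOnSmallBalls_unitLog` — with `r₀ := ‖p*‖` (`p* = p`, resp. `4`): for a unit `x` and
  `0 < r ≤ ‖p*‖`, `log_p(x·u) = log_p(x) + L(u)` for `‖1 − u‖ ≤ r` (`unitLog_mul`, `L` = the logarithmic
  series), `‖L(u)‖ ≤ ‖1 − u‖` (Lipschitz bound `norm_logSeries_le_norm`) and every `w` with `‖w‖ ≤ r` is
  `L(u)` with `‖1 − u‖ ≤ r` (`exists_logSeries_eq`; contraction constant `θ = r·p^{1/(p−1)} < 1`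
  because `r ≤ ‖p*‖`, cf. `norm_pstarPow_mul_rpow_lt_one`);
* `logVolumeCompatible_unitLog_of` — hence Prop 5.7 (i)(c) for `log_p` follows from the combinatorial
  named fact `LogVolumeCompatibleOfIsometric` (one line; recorded so consumers can chain).

Classical (Koblitz GTM 58 Ch. IV §1–2; Neukirch ANT II (5.5)); no definitions; nothing here bears on
[IUTchIII] Cor. 3.12.
-/

set_option autoImplicit false

noncomputable section

open Set Metric

namespace Literature.AnabelianGeometry.AbsoluteAnabelian

open Literature.IUT.LogVolume Literature.NumberTheory.Transcendental

variable (p : ℕ) [hp : Fact p.Prime]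
variable (K : Type*) [NontriviallyNormedField K] [instK : NormedAlgebra ℚ_[p] K]
include instK

/-- `p* ≠ 0` in `K`, `p* := p^{1 or 2}` (characteristic `0`). [cite: MochizukiAbsTopIII2015, Def 5.4 (iii) p. 126] -/
theorem pstarPow_cast_ne_zero : ((p ^ (if p = 2 then 2 else 1) : ℕ) : K) ≠ 0 := by
  haveI := IwasawaLog.charZero p (F := K)
  exact_mod_cast pow_ne_zero _ (Fact.out : p.Prime).ne_zero

/-- At radius `ρ := ‖p*‖` the contraction constant `θ := ρ · p^{1/(p−1)}` of the logarithmic series is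
`< 1` (`p` odd: `θ = p^{1/(p−1) − 1}`; `p = 2`: `θ = 2⁻² · 2`). [cite: MochizukiAbsTopIII2015, Def 5.4 (iii) p. 126] -/
theorem norm_pstarPow_mul_rpow_lt_one :
    ‖((p ^ (if p = 2 then 2 else 1) : ℕ) : K)‖ * (p : ℝ) ^ (1 / ((p : ℝ) - 1)) < 1 := by
  have hp : p.Prime := Fact.out
  have hp1 : (1 : ℝ) < p := by exact_mod_cast hp.one_lt
  rw [Nat.cast_pow, norm_pow, IwasawaLog.norm_natCast p p, Padic.norm_p]
  by_cases h2 : p = 2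
  · subst h2
    rw [if_pos rfl]
    norm_num
  · have h3 : (3 : ℝ) ≤ p := by exact_mod_cast (show 3 ≤ p by have := hp.two_le; omega)
    rw [if_neg h2, pow_one, ← Real.rpow_neg_one, ← Real.rpow_add (by linarith)]
    apply Real.rpow_lt_one_of_one_lt_of_neg hp1
    have : 1 / ((p : ℝ) - 1) < 1 := (div_lt_one (by linarith)).mpr (by linarith)
    linarith

variable {K}
variable [instU : IsUltrametricDist K] [instP : ProperSpace K]

omit hp instK instU instP in
/-- A closed ball of radius `r` around a unit `x` is `x · (1 + {‖1 − u‖ ≤ r})`: for `‖x‖ = 1`,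
`‖x·u − x‖ = ‖u − 1‖`. [cite: MochizukiAbsTopIII2015, Prop 5.7 (i) proof p. 139] -/
theorem mem_closedBall_unit_iff {x : K} (hx : ‖x‖ = 1) (r : ℝ) (y : K) :
    y ∈ closedBall x r ↔ ‖1 - x⁻¹ * y‖ ≤ r := by
  have hx0 : x ≠ 0 := norm_pos_iff.mp (by rw [hx]; exact one_pos)
  rw [mem_closedBall, dist_eq_norm, norm_sub_rev]
  have : x - y = x * (1 - x⁻¹ * y) := by field_simp
  rw [this, norm_mul, hx, one_mul]

omit instU instP in
/-- For `0 < r ≤ ‖p*‖` the contraction constant at radius `r` is `< 1` as well.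
[cite: MochizukiAbsTopIII2015, Prop 5.7 (i) proof p. 139] -/
theorem mul_rpow_lt_one_of_le_norm_pstarPow {r : ℝ}
    (hr : r ≤ ‖((p ^ (if p = 2 then 2 else 1) : ℕ) : K)‖) :
    r * (p : ℝ) ^ (1 / ((p : ℝ) - 1)) < 1 := by
  have hq : 0 ≤ (p : ℝ) ^ (1 / ((p : ℝ) - 1)) := Real.rpow_nonneg (Nat.cast_nonneg p) _
  exact (mul_le_mul_of_nonneg_right hr hq).trans_lt (norm_pstarPow_mul_rpow_lt_one p K)

/-- **Prop 5.7 (i)(c), analytic input, for the REAL logarithm**: S1's `unitLog = log_p` is isometric on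
small balls around units — with `r₀ := ‖p*‖`, for every unit `x` and `0 < r ≤ r₀`,
`log_p(x + {‖·‖ ≤ r}) = log_p(x) + {‖·‖ ≤ r}` ("`log_k` determines a bijection
`x + 𝔪_k^n ≅ log_k(x) + 𝔪_k^n`", p. 139). Discharges `IsIsometricOnSmallBalls` (TODO-merge abc-iut-S1 in
`LocalVolumesNonarchimedean.lean`) at `log := unitLog`.
[cite: MochizukiAbsTopIII2015, Prop 5.7 (i)(c) p. 138] -/
theorem isIsometricOnSmallBalls_unitLog : IsIsometricOnSmallBalls (unitLog : K → K) := by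
  refine ⟨‖((p ^ (if p = 2 then 2 else 1) : ℕ) : K)‖, norm_pos_iff.mpr (pstarPow_cast_ne_zero p K),
    fun x hx r hr hrle => ?_⟩
  have hθ := mul_rpow_lt_one_of_le_norm_pstarPow p hrle
  have hx0 : x ≠ 0 := norm_pos_iff.mp (by rw [hx]; exact one_pos)
  -- `r < 1`: from `θ < 1` and `p^{1/(p-1)} ≥ 1`
  have hp1 : (1 : ℝ) ≤ p := by exact_mod_cast (Fact.out : p.Prime).one_lt.le
  have hq : 1 ≤ (p : ℝ) ^ (1 / ((p : ℝ) - 1)) :=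
    Real.one_le_rpow hp1 (div_nonneg zero_le_one (by linarith))
  have hr1 : r < 1 := by
    calc r = r * 1 := (mul_one r).symm
      _ ≤ r * (p : ℝ) ^ (1 / ((p : ℝ) - 1)) := by gcongr
      _ < 1 := hθ
  ext z
  constructor
  · -- `log_p(y) = log_p(x) + L(x⁻¹ y)` with `‖L(x⁻¹ y)‖ ≤ ‖1 - x⁻¹ y‖ ≤ r`
    rintro ⟨y, hy, rfl⟩
    have hu : ‖1 - x⁻¹ * y‖ ≤ r := (mem_closedBall_unit_iff hx r y).mp hy
    have huP : IsPrincipal (x⁻¹ * y) := hu.trans_lt hr1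
    have hy' : y = x * (x⁻¹ * y) := by field_simp
    rw [mem_closedBall, dist_eq_norm, hy', unitLog_mul p hx huP.norm_eq_one, add_sub_cancel_left,
      unitLog_of_isPrincipal p huP]
    exact (norm_logSeries_le_norm p K hθ.le hu).trans hu
  · -- every `w` with `‖w‖ ≤ r` is `L(u)`, `‖1 - u‖ ≤ r`; take `y := x * u`
    intro hz
    rw [mem_closedBall, dist_eq_norm] at hz
    obtain ⟨u, hu, hLu⟩ := exists_logSeries_eq p K hθ hz
    have huP : IsPrincipal u := hu.trans_lt hr1
    refine ⟨x * u, (mem_closedBall_unit_iff hx r _).mpr ?_, ?_⟩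
    · rwa [← mul_assoc, inv_mul_cancel₀ hx0, one_mul]
    · rw [unitLog_mul p hx huP.norm_eq_one, unitLog_of_isPrincipal p huP, hLu, add_sub_cancel]

/-- Hence **Prop 5.7 (i)(c) for `log_p`**: granted the combinatorial named fact
`LogVolumeCompatibleOfIsometric` of `LocalVolumesNonarchimedean.lean` (isometric-on-small-balls ⇒
log-volume compatible; held by abc-iut-L4-t8), the real logarithm `unitLog` is log-volume compatible:
`μ_k^log(A) = μ_k^log(log_k(A))` for compact open `A ⊆ 𝒪_k^×` on which `log_k` is injective.
[cite: MochizukiAbsTopIII2015, Prop 5.7 (i)(c) p. 138] -/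
theorem logVolumeCompatible_unitLog_of [MeasurableSpace K] [BorelSpace K]
    (h : LogVolumeCompatibleOfIsometric (K := K)) : LogVolumeCompatible (unitLog : K → K) :=
  h unitLog (isIsometricOnSmallBalls_unitLog p)

end Literature.AnabelianGeometry.AbsoluteAnabelian

end
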